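import Mathlib
import Summits.MatrixMultiplication.MatrixMultiplication.Theses.LevelGradedCohnUmans
import Summits.MatrixMultiplication.MatrixMultiplication.Statement
import Literature.RepresentationTheory.FiniteGroups.CharacterDegrees
import Summits.MatrixMultiplication.MatrixMultiplication.Theorems.LevelGradedCohnUmansGradedPricing
import Summits.MatrixMultiplication.MatrixMultiplication.Theorems.LevelGradedCohnUmansGradedDesignFamilyStubColourPricing
import Summits.MatrixMultiplication.MatrixMultiplication.Theorems.LevelGradedCohnUmansGradedDesignFamilyStubTwoRowBudgetRate

/-!
# The two-colour wall family implies the crux — and `ω = 2`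
# (crux `LevelGradedCohnUmans.GradedDesignFamily`, stmt-MatrixMultiplication-7610; line
# `schur-weyl-colour-cells`, continuation lead c5: the line's sorry-free reduction, landed)

The line `schur-weyl-colour-cells` of the crux `GradedDesignFamily` (lead c1) is CLOSED MODULO ONE
registered stub, STUB C `stub_twoColourWallFamily`: for every `a > 0` and infinitely many `n`, a
`2`-colour-separated triple `X, Y, Z ⊆ 𝔖ₙ` — separated by the COLOUR CELL
`J₂(n) = span{g ↦ [c' ∘ g = c] : c, c' : [n] → [2]}` (the coefficient space of `(ℂ²)^{⊗n}`) — of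
volume `≥ (4ⁿ/n^{3/2})^{3/2} · n^{−a}`.  STUB A (Schur–Weyl pricing, `stub_colourPricing`, p97462)
and STUB B (two-row budget rate, `stub_twoRowBudgetRate`, p101413) are landed; the composition
A + B + C ⟹ crux lived only in the crux workfile
`Cruxes/GradedDesignFamily/Lines/schur_weyl_colour_cells.lean`.  This file lands it, with the
colour cell written as an explicit span (no new definitions):

* `TwoColour.colourTest_transl`, `TwoColour.colourSpan_biInv` — a two-sided translate of a
  colouring-incidence test is again one, so `J_r(n)` is BI-INVARIANT (the crux's first clause);
* `TwoColour.gradedDesignFamily_of_wallFamily` — the universality engine at `r = 2` against the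
  proxy wall `P(n) = 4ⁿ/n^{3/2}`: with `s = 2 + ε`, B gives `K, θ > 0` with
  `B_s(2,n) ≤ K P(n)^{s/2} n^{−θ}`; run C with `a = 3θ/(2s)` past `n^{θ/2} > K`; then
  `price ≤ B_s(2,n) < P^{s/2} n^{−θ/2} = (P^{3/2} n^{−a})^{s/3} ≤ V^{s/3}`;
* `gradedDesignFamily_of_twoColourWallFamily` — **STUB C ⟹ `GradedDesignFamily`** (hypothesis = the
  registered signature of `stub_twoColourWallFamily`, as a `Prop`);
* `omega_eq_two_of_twoColourWallFamily` — **STUB C ⟹ `ω(ℂ) = 2`** through the route's `closes`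
  and the landed `GradedPricing_of`: the open stub of this line, too, is SUMMIT-SIZED
  (kernel-checked certificate behind the lead's verdict; companions for the other two lines are
  `omega_eq_two_of_subfieldCell`, `omega_eq_two_of_lieCellFamilies`).

[cite: ElderFunkPrice2011 Thm 7 (Schur–Weyl pricing pattern); Regev1981 (two-row asymptotics);
CohnKleinbergSzegedyUmans2005 Thm 7.1]
-/

set_option linter.dupNamespace false

noncomputable section

open scoped BigOperators
open Literature.RepresentationTheory.FiniteGroups
open Summit.MatrixMultiplication.MatrixMultiplication.Theses.LevelGradedCohnUmans

namespace Summit.MatrixMultiplication.MatrixMultiplication.Theorems.GradedDesignFamily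

namespace TwoColour

/-! ## Bi-invariance of the colour cell -/

/-- A two-sided translate of a colouring-incidence test is again one:
`[c' ∘ (a g b) = c] = [(c' ∘ a) ∘ g = c ∘ b⁻¹]`. [folklore] -/
theorem colourTest_transl {n r : ℕ} (c c' : Fin n → Fin r) (a b g : Equiv.Perm (Fin n)) :
    (if c' ∘ (⇑(a * g * b)) = c then (1 : ℂ) else 0) =
      if (c' ∘ ⇑a) ∘ (⇑g) = c ∘ ⇑(b⁻¹ : Equiv.Perm (Fin n)) then (1 : ℂ) else 0 := by
  have key : (c' ∘ ⇑(a * g * b) = c) ↔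
      ((c' ∘ ⇑a) ∘ ⇑g = c ∘ ⇑(b⁻¹ : Equiv.Perm (Fin n))) := by
    constructor
    · intro h
      funext i
      have := congrFun h (b⁻¹ i)
      simp only [Function.comp_apply, Equiv.Perm.coe_mul] at this ⊢
      simpa using this
    · intro h
      funext i
      have := congrFun h (b i)
      simp only [Function.comp_apply, Equiv.Perm.coe_mul] at this ⊢
      simpa using this
  by_cases h : c' ∘ ⇑(a * g * b) = c
  · rw [if_pos h, if_pos (key.mp h)]
  · rw [if_neg h, if_neg (fun h' => h (key.mpr h'))]

/-- **The colour cell `J_r(n)` is bi-invariant** (the first clause of `GradedDesignFamily`, in its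
exact form, for the span of the colouring-incidence tests). [folklore] -/
theorem colourSpan_biInv (n r : ℕ) :
    ∀ f ∈ Submodule.span ℂ {f : Equiv.Perm (Fin n) → ℂ | ∃ c c' : Fin n → Fin r,
        f = fun g : Equiv.Perm (Fin n) => if c' ∘ (⇑g) = c then (1 : ℂ) else 0},
      ∀ a b : Equiv.Perm (Fin n), (fun g : Equiv.Perm (Fin n) => f (a * g * b)) ∈
        Submodule.span ℂ {f : Equiv.Perm (Fin n) → ℂ | ∃ c c' : Fin n → Fin r,
          f = fun g : Equiv.Perm (Fin n) => if c' ∘ (⇑g) = c then (1 : ℂ) else 0} := by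
  intro f hf a b
  induction hf using Submodule.span_induction with
  | mem f hf =>
      obtain ⟨c, c', rfl⟩ := hf
      refine Submodule.subset_span ⟨c ∘ ⇑(b⁻¹ : Equiv.Perm (Fin n)), c' ∘ ⇑a, funext fun g => ?_⟩
      exact colourTest_transl c c' a b g
  | zero => exact Submodule.zero_mem _
  | add f₁ f₂ _ _ h₁ h₂ => exact Submodule.add_mem _ h₁ h₂
  | smul t f _ h => exact Submodule.smul_mem _ t h

/-! ## The universality engine at `r = 2` against the proxy wall `P(n) = 4ⁿ / n^{3/2}` -/

/-- The proxy wall `P(n) = 4ⁿ/n^{3/2}` is positive for `n ≥ 1`. [folklore] -/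
theorem twoRowProxy_pos (n : ℕ) (hn : 1 ≤ n) : 0 < (4 : ℝ) ^ n / (n : ℝ) ^ ((3 : ℝ) / 2) := by
  have h : (0 : ℝ) < n := by exact_mod_cast hn
  positivity

/-- **The universality engine** (A + B + C ⟹ the crux's body at every `ε`).  Schur–Weyl pricing
(landed `stub_colourPricing`), the two-row budget rate (landed `stub_twoRowBudgetRate`) and a
two-colour wall family within every polynomial loss give, for every `ε > 0`, a bi-invariant test
space (`J₂(n)`) and a separated triple beating the graded budget: with `s = 2 + ε`, B yields `K` and
`θ > 0`; run the family with `a = 3θ/(2s)` past the threshold `n^{θ/2} > K`; then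
`price ≤ B_s(2,n) ≤ K P^{s/2} n^{−θ} < P^{s/2} n^{−θ/2} = (P^{3/2} n^{−a})^{s/3} ≤ (|X||Y||Z|)^{s/3}`.
[cite: CohnKleinbergSzegedyUmans2005, Thm 7.1] -/
theorem gradedDesignFamily_of_wallFamily
    (hC : ∀ a : ℝ, 0 < a → ∀ n₀ : ℕ, ∃ n : ℕ, n₀ ≤ n ∧ ∃ X Y Z : Finset (Equiv.Perm (Fin n)),
      (∀ x₀ ∈ X, ∀ z₀ ∈ Z, ∃ f ∈ Submodule.span ℂ {f : Equiv.Perm (Fin n) → ℂ |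
          ∃ c c' : Fin n → Fin 2, f = fun g : Equiv.Perm (Fin n) =>
            if c' ∘ (⇑g) = c then (1 : ℂ) else 0},
        ∀ x ∈ X, ∀ y ∈ Y, ∀ y' ∈ Y, ∀ z ∈ Z,
          (x = x₀ ∧ y = y' ∧ z = z₀ → f (x⁻¹ * y * y'⁻¹ * z) = 1) ∧
          (¬ (x = x₀ ∧ y = y' ∧ z = z₀) → f (x⁻¹ * y * y'⁻¹ * z) = 0)) ∧
      ((4 : ℝ) ^ n / (n : ℝ) ^ ((3 : ℝ) / 2)) ^ ((3 : ℝ) / 2) * (n : ℝ) ^ (-a) ≤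
        ((X.card * Y.card * Z.card : ℕ) : ℝ)) :
    GradedDesignFamily := by
  intro ε hε
  have hs : (2 : ℝ) < 2 + ε := by linarith
  obtain ⟨K, θ, hθ, hK⟩ := stub_twoRowBudgetRate (2 + ε) hs
  -- threshold: `n ≥ N ⇒ K < n^{θ/2}`
  obtain ⟨N, hN⟩ : ∃ N : ℕ, ∀ n : ℕ, N ≤ n → K < (n : ℝ) ^ (θ / 2) := by
    refine ⟨⌈(max K 1) ^ (2 / θ)⌉₊ + 1, fun n hn => ?_⟩
    have hM : 0 ≤ max K 1 := le_trans zero_le_one (le_max_right _ _)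
    have hlt : (max K 1) ^ (2 / θ) < (n : ℝ) := by
      have h1 := Nat.le_ceil ((max K 1) ^ (2 / θ))
      have h2 : ((⌈(max K 1) ^ (2 / θ)⌉₊ : ℕ) : ℝ) + 1 ≤ n := by exact_mod_cast hn
      linarith
    have hθ0 : θ ≠ 0 := ne_of_gt hθ
    calc K ≤ max K 1 := le_max_left _ _
      _ = ((max K 1) ^ (2 / θ)) ^ (θ / 2) := by
          rw [← Real.rpow_mul hM, show 2 / θ * (θ / 2) = 1 by field_simp, Real.rpow_one]
      _ < (n : ℝ) ^ (θ / 2) := Real.rpow_lt_rpow (Real.rpow_nonneg hM _) hlt (by positivity)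
  set a : ℝ := 3 * θ / (2 * (2 + ε)) with ha_def
  have ha : 0 < a := by positivity
  obtain ⟨n, hn, X, Y, Z, hsep, hV⟩ := hC a ha (max N 1)
  have hn1 : 1 ≤ n := le_trans (le_max_right _ _) hn
  have hnN : N ≤ n := le_trans (le_max_left _ _) hn
  have hnpos : (0 : ℝ) < n := by exact_mod_cast hn1
  set W : ℝ := (4 : ℝ) ^ n / (n : ℝ) ^ ((3 : ℝ) / 2) with hW_def
  have hWn : 0 < W := twoRowProxy_pos n hn1
  refine ⟨Equiv.Perm (Fin n), inferInstance, inferInstance,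
    Submodule.span ℂ {f : Equiv.Perm (Fin n) → ℂ | ∃ c c' : Fin n → Fin 2,
      f = fun g : Equiv.Perm (Fin n) => if c' ∘ (⇑g) = c then (1 : ℂ) else 0},
    X, Y, Z, colourSpan_biInv n 2, hsep, ?_⟩
  have h1 := stub_colourPricing n 2 (2 + ε)
  have h2 : (∑ μ : Nat.Partition n, if Multiset.card μ.parts ≤ 2 then
      (Literature.NumberTheory.DiophantineGeometry.numStandardTableaux μ : ℝ) ^ (2 + ε) else 0) ≤
      K * W ^ ((2 + ε) / 2) * (n : ℝ) ^ (-θ) := hK n hn1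
  have h3 : K * W ^ ((2 + ε) / 2) * (n : ℝ) ^ (-θ) < W ^ ((2 + ε) / 2) * (n : ℝ) ^ (-(θ / 2)) := by
    have hKlt : K < (n : ℝ) ^ (θ / 2) := hN n hnN
    have hpos1 : 0 < W ^ ((2 + ε) / 2) := Real.rpow_pos_of_pos hWn _
    have hpos2 : 0 < (n : ℝ) ^ (-(θ / 2)) := Real.rpow_pos_of_pos hnpos _
    have hpos3 : 0 < (n : ℝ) ^ (θ / 2) := Real.rpow_pos_of_pos hnpos _
    have e : (n : ℝ) ^ (-θ) = (n : ℝ) ^ (-(θ / 2)) * ((n : ℝ) ^ (θ / 2))⁻¹ := by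
      rw [← Real.rpow_neg hnpos.le (θ / 2), ← Real.rpow_add hnpos]
      congr 1
      ring
    have hKC : K * ((n : ℝ) ^ (θ / 2))⁻¹ < 1 := by
      rw [mul_inv_lt_iff₀ hpos3, one_mul]
      exact hKlt
    rw [e]
    calc K * W ^ ((2 + ε) / 2) * ((n : ℝ) ^ (-(θ / 2)) * ((n : ℝ) ^ (θ / 2))⁻¹)
        = (K * ((n : ℝ) ^ (θ / 2))⁻¹) * (W ^ ((2 + ε) / 2) * (n : ℝ) ^ (-(θ / 2))) := by ring
      _ < 1 * (W ^ ((2 + ε) / 2) * (n : ℝ) ^ (-(θ / 2))) :=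
          mul_lt_mul_of_pos_right hKC (mul_pos hpos1 hpos2)
      _ = W ^ ((2 + ε) / 2) * (n : ℝ) ^ (-(θ / 2)) := one_mul _
  have h4 : W ^ ((2 + ε) / 2) * (n : ℝ) ^ (-(θ / 2)) =
      (W ^ ((3 : ℝ) / 2) * (n : ℝ) ^ (-a)) ^ ((2 + ε) / 3) := by
    rw [Real.mul_rpow (Real.rpow_nonneg hWn.le _) (Real.rpow_nonneg hnpos.le _),
      ← Real.rpow_mul hWn.le, ← Real.rpow_mul hnpos.le]
    congr 1
    · congr 1
      ring
    · congr 1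
      rw [ha_def]
      field_simp
  have h5 : (W ^ ((3 : ℝ) / 2) * (n : ℝ) ^ (-a)) ^ ((2 + ε) / 3) ≤
      ((X.card * Y.card * Z.card : ℕ) : ℝ) ^ ((2 + ε) / 3) :=
    Real.rpow_le_rpow (mul_nonneg (Real.rpow_nonneg hWn.le _) (Real.rpow_nonneg hnpos.le _)) hV
      (by linarith)
  calc (∑ᶠ χ ∈ irrChars (Equiv.Perm (Fin n)) ∩
        ((Submodule.span ℂ {f : Equiv.Perm (Fin n) → ℂ | ∃ c c' : Fin n → Fin 2,
            f = fun g : Equiv.Perm (Fin n) => if c' ∘ (⇑g) = c then (1 : ℂ) else 0}) :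
          Set (Equiv.Perm (Fin n) → ℂ)), (χ 1).re ^ (2 + ε))
        ≤ (∑ μ : Nat.Partition n, if Multiset.card μ.parts ≤ 2 then
            (Literature.NumberTheory.DiophantineGeometry.numStandardTableaux μ : ℝ) ^ (2 + ε)
            else 0) := h1
    _ ≤ K * W ^ ((2 + ε) / 2) * (n : ℝ) ^ (-θ) := h2
    _ < W ^ ((2 + ε) / 2) * (n : ℝ) ^ (-(θ / 2)) := h3
    _ = (W ^ ((3 : ℝ) / 2) * (n : ℝ) ^ (-a)) ^ ((2 + ε) / 3) := h4
    _ ≤ ((X.card * Y.card * Z.card : ℕ) : ℝ) ^ ((2 + ε) / 3) := h5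

end TwoColour

/-! ## STUB C ⟹ crux ⟹ `ω = 2` -/

/-- **The two-colour wall family implies the crux**: the registered open stub
`stub_twoColourWallFamily` of the line `schur-weyl-colour-cells` (as a `Prop`, verbatim) gives
`GradedDesignFamily` (pricing A and budget rate B are landed; this is the line's composition).
[cite: CohnKleinbergSzegedyUmans2005, Thm 7.1] -/
theorem gradedDesignFamily_of_twoColourWallFamily
    (h : ∀ a : ℝ, 0 < a → ∀ n₀ : ℕ, ∃ n : ℕ, n₀ ≤ n ∧ ∃ X Y Z : Finset (Equiv.Perm (Fin n)),
      (∀ x₀ ∈ X, ∀ z₀ ∈ Z, ∃ f ∈ Submodule.span ℂ {f : Equiv.Perm (Fin n) → ℂ |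
          ∃ c c' : Fin n → Fin 2, f = fun g : Equiv.Perm (Fin n) =>
            if c' ∘ (⇑g) = c then (1 : ℂ) else 0},
        ∀ x ∈ X, ∀ y ∈ Y, ∀ y' ∈ Y, ∀ z ∈ Z,
          (x = x₀ ∧ y = y' ∧ z = z₀ → f (x⁻¹ * y * y'⁻¹ * z) = 1) ∧
          (¬ (x = x₀ ∧ y = y' ∧ z = z₀) → f (x⁻¹ * y * y'⁻¹ * z) = 0)) ∧
      ((4 : ℝ) ^ n / (n : ℝ) ^ ((3 : ℝ) / 2)) ^ ((3 : ℝ) / 2) * (n : ℝ) ^ (-a) ≤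
        ((X.card * Y.card * Z.card : ℕ) : ℝ)) :
    Summit.MatrixMultiplication.MatrixMultiplication.Theses.LevelGradedCohnUmans.GradedDesignFamily :=
  TwoColour.gradedDesignFamily_of_wallFamily h

/-- **The open stub of the line `schur-weyl-colour-cells` is SUMMIT-SIZED**:
`stub_twoColourWallFamily ⟹ ω(ℂ) = 2`, through the route's deciding theorem `closes` fed with the
landed `GradedPricing_of`.  A constructive close of the line is a proof of `ω = 2`.
[cite: CohnKleinbergSzegedyUmans2005, Thm 7.1] -/
theorem omega_eq_two_of_twoColourWallFamily
    (h : ∀ a : ℝ, 0 < a → ∀ n₀ : ℕ, ∃ n : ℕ, n₀ ≤ n ∧ ∃ X Y Z : Finset (Equiv.Perm (Fin n)),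
      (∀ x₀ ∈ X, ∀ z₀ ∈ Z, ∃ f ∈ Submodule.span ℂ {f : Equiv.Perm (Fin n) → ℂ |
          ∃ c c' : Fin n → Fin 2, f = fun g : Equiv.Perm (Fin n) =>
            if c' ∘ (⇑g) = c then (1 : ℂ) else 0},
        ∀ x ∈ X, ∀ y ∈ Y, ∀ y' ∈ Y, ∀ z ∈ Z,
          (x = x₀ ∧ y = y' ∧ z = z₀ → f (x⁻¹ * y * y'⁻¹ * z) = 1) ∧
          (¬ (x = x₀ ∧ y = y' ∧ z = z₀) → f (x⁻¹ * y * y'⁻¹ * z) = 0)) ∧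
      ((4 : ℝ) ^ n / (n : ℝ) ^ ((3 : ℝ) / 2)) ^ ((3 : ℝ) / 2) * (n : ℝ) ^ (-a) ≤
        ((X.card * Y.card * Z.card : ℕ) : ℝ)) :
    Literature.Computability.AlgebraicComplexity.omega ℂ = 2 :=
  MatrixMultiplication_iff.1
    (closes GradedPricing.GradedPricing_of (gradedDesignFamily_of_twoColourWallFamily h))

end Summit.MatrixMultiplication.MatrixMultiplication.Theorems.GradedDesignFamily

end
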